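import Summits.BirchSwinnertonDyer.BirchSwinnertonDyer.Theorems.ClassRecordThreeCornerAtThreeBranchesDefs
import Summits.BirchSwinnertonDyer.BirchSwinnertonDyer.Theorems.ClassRecordThreeCornerAtThreeTwinKatoFacts
import Summits.BirchSwinnertonDyer.BirchSwinnertonDyer.Theorems.ErratumRoadFiveNonSurjCornerBranchesAn
import Summits.BirchSwinnertonDyer.Rank1Residual.X11b.TwistTransportIrr
import Summits.BirchSwinnertonDyer.BirchSwinnertonDyer.Theses.ClassRecordThree
import HarnessLib

/-!
# Route `ClassRecordThree` (rung K2@3), crux 7 `CornerAtThree` (item stmt-BirchSwinnertonDyer-19111): the two GLUES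
# of the proposed split — `cornerAtThree_of_branches : StepL → Upper → TwistLower → TwistMu → ⟨bundle⟩ →
# CornerAtThree` (literal `μ = 0` child) and `cornerAtThree_of_branchesAn : StepL → Upper → TwistLower → TwistMuAn
# → ⟨bundle + F1 at 3 ∥ N⟩ → CornerAtThree` (ANALYTIC child, through the Kato `μ`-transfer at `3 ∥ N` WITHOUT big
# image) (cell `bsd-stepL`, seat `bsd-stepL-corner-p1` g6; planner g28 ruling (B); `--supports stmt-BirchSwinnertonDyer-19111`)

The children are the Theses-free constants of `Theorems/ClassRecordThreeCornerAtThreeBranchesDefs.lean`. The bundle of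
the literal glue, `KatoTwinFactsThree`, is the conjunction of the TWELVE named facts consumed by g5's
`X11b.cornerTwistAt_of_lowerTwists_of_katoFacts_of_mu_eq_zero` (p479217), in that order: Stein–Wuthrich 2013 Thm. 6.1
(split ∕ non-split), GZK, modularity (entire `L`, parametrisation data), Greenberg–Stevens, Kato (12.2.1), Thm. 12.4,
the §17.13 inputs at a non-split ∕ split multiplicative odd prime, Greenberg 1999 Thm. 1.5, Wuthrich 2014 Cor. 18;
the analytic glue's bundle `KatoTwinFactsThreeAn` appends `Kato2004.exists_multDivisibilityInputs_fine` (F1 at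
`p ∥ N`, p487500). Both are written as ONE conjunction binder whose text the planner pastes as the support child's
statement (route-file conjunction, like `PublishedInputsThree`). The conclusion is the route decl
`Theses.ClassRecordThree.CornerAtThree` BY NAME (this module imports the route file; the item is `wanted_by`
`KolyvaginRoadThree` too, whose decl is a by-name alias served by the same theorem up to unfolding).

* §1 `X11b.cornerTwistAt_of_lowerTwists_of_katoFacts_of_muAn` — conjunct (Tw) from the twelve facts + F1-mult + the
  lower half at the twins + the ANALYTIC certificate at the twins: at each odd Heegner twin `Wd = Cd • E^{(d_K)}` the
  twin is multiplicative at `3` (`hasMultiplicativeReductionAtPrime_twist_of_heegner'`), of analytic rank `0`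
  (`analyticRank_heegnerTwist_eq_zero`), with `E^{(d_K)}[3]` irreducible (`hasIrreducibleModPGaloisRep_twist_model`)
  and `ρ̄` not onto (`not_surj_twist_model`), so `multDivisibilityAt_of_katoFacts_of_muAn` (this seat, p488499; the
  transfer `MultMu.mu_eq_zero_of_multFine` inside) gives the twin's divisibility, whence its upper half and `BSD(Wd,3)`.
* §2 the two glues.

HONEST FRAMING: theorems only (no definition, no named fact, no `sorry`); CONDITIONAL on the displayed hypotheses;
nothing asserted about any curve; nothing booked; item 19111 does NOT close; BSD is not advanced; no census word moves
(T7). PARTITION (D-0054): O2@3 (B10) × T4″ corner × 3 ∥ N — types-the-object-of; closes none.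

References: [Kato2004Asterisque] Thm. 12.4–12.6, (14.9.3), §17.13; [Wuthrich2014] p. 391, Cor. 18; [Kobayashi2006DocMath]
Thm. 4.1; [GreenbergLNM1716] Thm. 1.5, Conj. 1.11; [SteinWuthrich2013] Thm. 6.1; [SilvermanAEC2009] X.5 Cor. 5.4;
[Miller2011LMS] Def. 1.1; tree: `Theorems/ClassRecordThreeCornerAtThreeTwinKato{Rat,Facts}.lean` (p477889 ∕ p479217).
-/

set_option autoImplicit false
set_option linter.dupNamespace false

noncomputable section

open scoped Classical NumberField MatrixGroups ModularForm

namespace Summit.BirchSwinnertonDyer.Rank1Residual.X11b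

open CongruenceSubgroup WeierstrassCurve NumberField IsDedekindDomain Field
  Literature.NumberTheory.EllipticCurves
  Literature.NumberTheory.EllipticCurves.ModularForms
  Literature.NumberTheory.EllipticCurves.Rank1Residual
  Literature.NumberTheory.EllipticCurves.Rank1Residual.Typed
  Literature.NumberTheory.EllipticCurves.Wuthrich2014
  Literature.NumberTheory.EllipticCurves.SteinWuthrich2013
  Literature.NumberTheory.EllipticCurves.Greenberg1999
  Literature.NumberTheory.EllipticCurves.Kato2004
  Summit.BirchSwinnertonDyer.Rank1Residual
  Summit.BirchSwinnertonDyer.Rank1Residual.X11b.Three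
  Summit.BirchSwinnertonDyer.BirchSwinnertonDyer.Theorems

/-! ### §1 Conjunct (Tw) from the ANALYTIC certificate at the twins -/

/-- **Conjunct (Tw) `Three.CornerTwistAt W` of crux 7 `CornerAtThree` (item 19111) from NAMED facts + the lower half
at every odd Heegner twin + the ANALYTIC `μ = 0` certificate at every such twin.** Facts: Stein–Wuthrich Thm. 6.1
(`hJs`, `hJn`), GZK, modularity (`hmod`, `hpar`), Greenberg–Stevens, the six facts of the twin's rational Kato layer
(`hne`, `h12`, `hns`, `hsp`, `h15`, `h18`) and F1 at `p ∥ N` (`hfine`). At each twin `Wd = Cd • E^{(d_K)}`: multiplicative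
at `3`, `r_an = 0`, `E^{(d_K)}[3]` irreducible, `ρ̄` not onto (twist lemmas), so `multDivisibilityAt_of_katoFacts_of_muAn`
with the certificate `hAn` read on `Wd` gives `MultDivisibilityAt Wd 3`, then `missingUpperBoundAt_of_multDivisibilityAt_of_analyticRank_eq_zero`
and `Typed.missingPPartAt_of_lower_of_upper` give `BSD(Wd,3)`. CONDITIONAL on `hlow`, `hAn`; nothing booked.
[cite: Kato2004Asterisque, Thm. 12.6 (p. 222) and §17.13 (pp. 279–280)] [cite: Wuthrich2014, Cor. 18 (p. 398)]
[cite: SteinWuthrich2013, Thm. 6.1 (p. 20)] [cite: SilvermanAEC2009, X.5 Cor. 5.4] [cite: Miller2011LMS, §1 and Def. 1.1] -/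
theorem cornerTwistAt_of_lowerTwists_of_katoFacts_of_muAn
    (hJs : thm61_splitMultiplicative) (hJn : thm61_nonsplitMultiplicative)
    (hGZK : rank_eq_analyticRank_of_analyticRank_le_one) (hmod : hasEntireLFunction_rat)
    (hpar : nonempty_modularParametrizationData)
    (hGS : ∀ (W : WeierstrassCurve ℚ) [W.IsElliptic] [W.IsGloballyMinimal] (p : ℕ) [Fact p.Prime],
      greenberg_stevens (W := W) (p := p))
    (hne : Kato2004.nonempty_iwasawaH1Data) (h12 : Kato2004.thm12_4)
    (hns : Kato2004.exists_multDivisibilityInputs_nonsplit)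
    (hsp : Kato2004.exists_multDivisibilityInputs_split)
    (h15 : thm15_isTorsion_multiplicative_rat)
    (h18 : Wuthrich2014.corollary18_padicLFunction_mem_iwasawaAlgebra_multiplicative)
    (hfine : Kato2004.exists_multDivisibilityInputs_fine)
    (W : WeierstrassCurve ℚ) [W.IsElliptic] [W.IsGloballyMinimal]
    (hlow : ∀ (K : Type) [Field K] [NumberField K]
      (Wd : WeierstrassCurve ℚ) [Wd.IsElliptic] [Wd.IsGloballyMinimal] (Cd : VariableChange ℚ),
      ClassX11b W 3 → ¬ Surj W 3 → IsImaginaryQuadratic K → Odd (NumberField.discr K) →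
      SatisfiesHeegnerHypothesis (W.conductorNorm ℤ) K →
      (W.quadraticTwist (NumberField.discr K : ℚ)).entireLFunction 1 ≠ 0 →
      Cd • W.quadraticTwist (NumberField.discr K : ℚ) = Wd → Typed.MissingLowerBoundAt Wd 3)
    (hAn : ∀ (K : Type) [Field K] [NumberField K]
      (Wd : WeierstrassCurve ℚ) [Wd.IsElliptic] [Wd.IsGloballyMinimal] (Cd : VariableChange ℚ),
      ClassX11b W 3 → ¬ Surj W 3 → IsImaginaryQuadratic K → Odd (NumberField.discr K) →
      SatisfiesHeegnerHypothesis (W.conductorNorm ℤ) K →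
      (W.quadraticTwist (NumberField.discr K : ℚ)).entireLFunction 1 ≠ 0 →
      Cd • W.quadraticTwist (NumberField.discr K : ℚ) = Wd →
      ∀ {N : ℕ} [NeZero N] (f : CuspForm (Gamma0 N) 2), IsNewformOf Wd f →
      ∀ (ϖ : ℚ), (ϖ : ℝ) * Wd.realPeriodRat = plusPeriod f →
      ∀ (a : ℚ_[3]) (L : PowerSeries ℚ_[3]),
        (Wd.HasSplitMultiplicativeReductionAtPrime 3 → a = 1) →
        (¬ Wd.HasSplitMultiplicativeReductionAtPrime 3 → a = -1) →
        IsMultPAdicLFunctionOf f 3 a L →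
        ∃ n : ℕ, ‖PowerSeries.coeff n (PowerSeries.C ((ϖ : ℚ) : ℚ_[3]) * L)‖ = 1) :
    CornerTwistAt W := by
  intro K _ _ Wd _ _ Cd hX hnsj hKq hodd hHN hLt hWd
  have hD0 : (NumberField.discr K : ℚ) ≠ 0 := by exact_mod_cast NumberField.discr_ne_zero K
  have hmultd : Wd.HasMultiplicativeReductionAtPrime 3 :=
    hasMultiplicativeReductionAtPrime_twist_of_heegner' W 3 K hKq hHN hX.2.2.1 Cd hWd
  have hrd : Wd.analyticRank = 0 := analyticRank_heegnerTwist_eq_zero W K hLt Cd hWd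
  have hirrd : Wd.HasIrreducibleModPGaloisRep 3 :=
    hasIrreducibleModPGaloisRep_twist_model W 3 K hKq.1 hX.2.2.2 Cd hWd
  have hnsd : ¬ Surj Wd 3 := not_surj_twist_model W 3 hD0 hnsj Cd hWd
  have hdiv : MultDivisibilityAt Wd 3 :=
    multDivisibilityAt_of_katoFacts_of_muAn hne h12 hns hsp h15 h18 hfine Wd 3 (by decide) hmultd hirrd hnsd
      (fun f hf ϖ hϖ a L hsa hna hL ↦ hAn K Wd Cd hX hnsj hKq hodd hHN hLt hWd f hf ϖ hϖ a L hsa hna hL)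
  have hup : Typed.MissingUpperBoundAt Wd 3 :=
    missingUpperBoundAt_of_multDivisibilityAt_of_analyticRank_eq_zero hJs hJn hGZK hmod hpar Wd 3 (hGS Wd 3)
      (by decide) hmultd hrd hdiv
  exact Typed.bsdp_of_missingPPartAt Wd 3 hGZK (by rw [hrd]; exact zero_le_one)
    (Typed.missingPPartAt_of_lower_of_upper Wd 3 (hlow K Wd Cd hX hnsj hKq hodd hHN hLt hWd) hup)

end Summit.BirchSwinnertonDyer.Rank1Residual.X11b

namespace Summit.BirchSwinnertonDyer.BirchSwinnertonDyer.Theorems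

open CongruenceSubgroup WeierstrassCurve NumberField IsDedekindDomain Field
  Literature.NumberTheory.EllipticCurves
  Literature.NumberTheory.EllipticCurves.ModularForms
  Literature.NumberTheory.EllipticCurves.Rank1Residual
  Literature.NumberTheory.EllipticCurves.Rank1Residual.Typed
  Literature.NumberTheory.EllipticCurves.Wuthrich2014
  Literature.NumberTheory.EllipticCurves.SteinWuthrich2013
  Literature.NumberTheory.EllipticCurves.Greenberg1999
  Literature.NumberTheory.EllipticCurves.Kato2004
  Summit.BirchSwinnertonDyer.Rank1Residual
  Summit.BirchSwinnertonDyer.Rank1Residual.X11b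
  Summit.BirchSwinnertonDyer.Rank1Residual.X11b.Three

/-! ### §2 The glues -/

/-- **GLUE of the split of crux 7 `CornerAtThree` (item 19111) with the LITERAL `μ = 0` child: StepL → Upper →
TwistLower → TwistMu → `KatoTwinFactsThree` → `CornerAtThree`.** The bundle binder `hF` is the conjunction of the
twelve named facts (Stein–Wuthrich Thm. 6.1 ×2, GZK, entire `L`, parametrisation data, Greenberg–Stevens, Kato
(12.2.1), Thm. 12.4, §17.13 inputs non-split ∕ split, Greenberg Thm. 1.5, Wuthrich Cor. 18), verbatim the text the
planner files as the support child. Conjunct (Tw) by g5's `X11b.cornerTwistAt_of_lowerTwists_of_katoFacts_of_mu_eq_zero`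
(p479217); conjuncts 1 and 3 verbatim. CONDITIONAL; closes nothing by itself.
[cite: Kato2004Asterisque, Thm. 12.4 (p. 221) and §17.13 (pp. 279–280)] [cite: Wuthrich2014, Cor. 18 (p. 398)]
[cite: GreenbergLNM1716, Thm. 1.5 (p. 61) and §1 Conj. 1.11 (shape)] [cite: SteinWuthrich2013, Thm. 6.1 (p. 20)] -/
theorem cornerAtThree_of_branches (hS : CornerAtThreeStepL) (hU : CornerAtThreeUpper)
    (hlow : CornerAtThreeTwistLower) (hμ : CornerAtThreeTwistMu)
    (hF : thm61_splitMultiplicative ∧ thm61_nonsplitMultiplicative ∧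
      rank_eq_analyticRank_of_analyticRank_le_one ∧ WeierstrassCurve.hasEntireLFunction_rat ∧
      nonempty_modularParametrizationData ∧
      (∀ (W : WeierstrassCurve ℚ) [W.IsElliptic] [W.IsGloballyMinimal] (p : ℕ) [Fact p.Prime],
        greenberg_stevens (W := W) (p := p)) ∧
      Kato2004.nonempty_iwasawaH1Data ∧ Kato2004.thm12_4 ∧
      Kato2004.exists_multDivisibilityInputs_nonsplit ∧ Kato2004.exists_multDivisibilityInputs_split ∧
      thm15_isTorsion_multiplicative_rat ∧
      Wuthrich2014.corollary18_padicLFunction_mem_iwasawaAlgebra_multiplicative) :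
    Summit.BirchSwinnertonDyer.BirchSwinnertonDyer.Theses.ClassRecordThree.CornerAtThree := by
  obtain ⟨hJs, hJn, hGZK, hmod, hpar, hGS, hne, h12, hns, hsp, h15, h18⟩ := hF
  intro W _ _
  exact ⟨hS W, cornerTwistAt_of_lowerTwists_of_katoFacts_of_mu_eq_zero hJs hJn hGZK hmod hpar hGS hne h12 hns hsp
    h15 h18 W (fun K _ _ Wd _ _ Cd ↦ hlow W K Wd Cd) (fun K _ _ Wd _ _ Cd ↦ hμ W K Wd Cd), hU W⟩

/-- **GLUE VARIANT of the split of crux 7 `CornerAtThree` (item 19111) with the ANALYTIC child: StepL → Upper →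
TwistLower → TwistMuAn → `KatoTwinFactsThreeAn` → `CornerAtThree`.** The bundle binder `hF` is the twelve facts of
`KatoTwinFactsThree` followed by `Kato2004.exists_multDivisibilityInputs_fine` (F1 at `p ∥ N`). Conjunct (Tw) by §1
(the `μ`-transfer at `3 ∥ N` without big image inside); conjuncts 1 and 3 verbatim. CONDITIONAL; closes nothing.
[cite: Kato2004Asterisque, Thm. 12.6 (p. 222), (14.9.3) (p. 240) and §17.13 (pp. 279–280)]
[cite: Wuthrich2014, p. 391 and Cor. 18 (p. 398)] [cite: GreenbergLNM1716, §1 Conj. 1.11 (shape)] -/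
theorem cornerAtThree_of_branchesAn (hS : CornerAtThreeStepL) (hU : CornerAtThreeUpper)
    (hlow : CornerAtThreeTwistLower) (hμ : CornerAtThreeTwistMuAn)
    (hF : thm61_splitMultiplicative ∧ thm61_nonsplitMultiplicative ∧
      rank_eq_analyticRank_of_analyticRank_le_one ∧ WeierstrassCurve.hasEntireLFunction_rat ∧
      nonempty_modularParametrizationData ∧
      (∀ (W : WeierstrassCurve ℚ) [W.IsElliptic] [W.IsGloballyMinimal] (p : ℕ) [Fact p.Prime],
        greenberg_stevens (W := W) (p := p)) ∧
      Kato2004.nonempty_iwasawaH1Data ∧ Kato2004.thm12_4 ∧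
      Kato2004.exists_multDivisibilityInputs_nonsplit ∧ Kato2004.exists_multDivisibilityInputs_split ∧
      thm15_isTorsion_multiplicative_rat ∧
      Wuthrich2014.corollary18_padicLFunction_mem_iwasawaAlgebra_multiplicative ∧
      Kato2004.exists_multDivisibilityInputs_fine) :
    Summit.BirchSwinnertonDyer.BirchSwinnertonDyer.Theses.ClassRecordThree.CornerAtThree := by
  obtain ⟨hJs, hJn, hGZK, hmod, hpar, hGS, hne, h12, hns, hsp, h15, h18, hfine⟩ := hF
  intro W _ _
  exact ⟨hS W, cornerTwistAt_of_lowerTwists_of_katoFacts_of_muAn hJs hJn hGZK hmod hpar hGS hne h12 hns hsp h15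
    h18 hfine W (fun K _ _ Wd _ _ Cd ↦ hlow W K Wd Cd) (fun K _ _ Wd _ _ Cd ↦ hμ W K Wd Cd), hU W⟩

end Summit.BirchSwinnertonDyer.BirchSwinnertonDyer.Theorems

end
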